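import Summits.AtomisticToContinuum.HydrodynamicLimit.Theses.SpeedCapSurgery
import Summits.AtomisticToContinuum.HydrodynamicLimit.Theorems.SpeedCapSurgeryMaxSpeedBoundLogEnergeticCountTools
import Summits.AtomisticToContinuum.HydrodynamicLimit.Theorems.SpeedCapSurgeryMaxSpeedBoundLogOneRarePathwise
import Summits.AtomisticToContinuum.HydrodynamicLimit.Theorems.OneFlightGossipEngineEnergyCurrentTailsLevelCensusEventMeasurable
import HarnessLib

/-!
# Energetic collisions are rare, GIVEN Gaussian velocity tails and the one-rare contact ceiling

Helper file of the crux line `registered` (birth skeleton) of `SpeedCapSurgery.MaxSpeedBoundLog`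
(stmt-AtomisticToContinuum-9629): the dynamic stub `stub_energeticCollisionsRare` of the line, in its
exact registered shape, DERIVED FROM the two route items it was designed to consume —
`GaussianVelocityTails` (stmt-9633: uniform-in-`N` exponential velocity moments in the mean along
the flow) and `ContactIntensityDominationOneRare` (stmt-16939: the one-rare-participant Stosszahlansatz
ceiling for ordered-pair collision sums). With the line's composition and its two landed stubs this
is the route's glue `TailsToMaxSpeedR` (stmt-16990) at collision level.

`energeticCollisionsRare_of`: for continuous positive profiles take `σ₀ = min σ₀(9633) σ₀(16939) 1/2`;
for `0 < σ < σ₀`, `t > 0`, a flow family: the measurable majorant is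
`g N = 𝟙_good · eventSum (Φ N) 0 t {c_N² < ‖v₁⁺‖² + ‖v₂⁺‖²}` (`censusLedger_eventMeasurable`,
`ncard_energetic_le_eventSum`) at level `c_N = C₁√log(N+2)`, `C₁ = √(12/c)` with `c` the exponent of
the Gaussian moments; pathwise `g N ≤` the one-rare ordered-pair sum with `k = 0` and the continuous
mark `ψ_N(v) = min(1, e^{a(‖v‖² − c_N²/2)})`, `a = c/2` (`eventSum_le_oneRareSum`: an energetic
collision has a pre-collisional participant with `2‖v⁻‖² > c_N²`); the ceiling bounds `∫ g N` by
`C · σ²(N+1)^{1/3}/(N+1) · ∫_0^t E⊗E[Σᵢⱼ ψ_N(vᵢ)‖vᵢ − v'ⱼ‖] dτ`, and the pointwise Chernoff bound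
`ψ_N(v)‖v − w‖ ≤ e^{-a c_N²/2}(2 + a⁻¹ + c⁻¹) e^{c‖v‖²} e^{c‖w‖²}` with Tonelli and the moment bound
`E[Σᵢ e^{c‖vᵢ(τ)‖²}] = (N+1) E[expVelocityMoment c] ≤ (N+1) C_T` give
`∫ g N ≤ C C_T² (2 + a⁻¹ + c⁻¹) t · (N+1)² (N+2)^{-3} → 0` (`e^{-a c_N²/2} = (N+2)^{-3}`).

References: Nachtergaele–Yau 2003 §2.3; Gallagher–Saint-Raymond–Texier 2013 §4;
Cercignani–Illner–Pulvirenti 1994 App. 4.A.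
-/

noncomputable section

open MeasureTheory Set Filter Topology
open scoped ENNReal InnerProductSpace BigOperators

namespace Summit.AtomisticToContinuum.HydrodynamicLimit.Theorems.MaxSpeedBoundLogLine

open Literature.MathematicalPhysics.KineticTheory Literature.Analysis.FluidPDE
open Summit.AtomisticToContinuum.HydrodynamicLimit.Theorems.EnergyCurrentTailsLevelCensus

/-! ## The one-rare mark and its Chernoff bound -/

/-- **Pointwise Chernoff bound for the one-rare flux mark.** For `0 < a`, `c = 2a`, a level `L` and
velocities `v, w`: `min(1, e^{a(‖v‖² − L)}) · ‖v − w‖ ≤ e^{-aL}(2 + a⁻¹ + c⁻¹) e^{c‖v‖²} e^{c‖w‖²}`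
(`‖v − w‖ ≤ ‖v‖ + ‖w‖`, `x ≤ (1 + α⁻¹)e^{αx²}`, `e^{a‖v‖²} ≤ e^{c‖v‖²}`, `1 ≤ e^{c‖·‖²}`). -/
theorem oneRareMark_mul_norm_sub_le {a : ℝ} (ha : 0 < a) (L : ℝ) (v w : V3) :
    min 1 (Real.exp (a * (‖v‖ ^ 2 - L))) * ‖v - w‖ ≤
      Real.exp (-(a * L)) * (2 + a⁻¹ + (2 * a)⁻¹) *
        (Real.exp (2 * a * ‖v‖ ^ 2) * Real.exp (2 * a * ‖w‖ ^ 2)) := by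
  have hmin : min 1 (Real.exp (a * (‖v‖ ^ 2 - L))) ≤ Real.exp (-(a * L)) * Real.exp (a * ‖v‖ ^ 2) := by
    rw [← Real.exp_add]
    refine (min_le_right _ _).trans (le_of_eq ?_)
    ring_nf
  have hmin0 : 0 ≤ min 1 (Real.exp (a * (‖v‖ ^ 2 - L))) := le_min zero_le_one (Real.exp_nonneg _)
  have hvw : ‖v - w‖ ≤ ‖v‖ + ‖w‖ := norm_sub_le _ _
  have hv : ‖v‖ ≤ (1 + a⁻¹) * Real.exp (a * ‖v‖ ^ 2) := le_const_mul_exp_mul_sq ha ‖v‖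
  have h2a : 0 < 2 * a := by positivity
  have hw : ‖w‖ ≤ (1 + (2 * a)⁻¹) * Real.exp (2 * a * ‖w‖ ^ 2) := le_const_mul_exp_mul_sq h2a ‖w‖
  have hea : Real.exp (a * ‖v‖ ^ 2) * Real.exp (a * ‖v‖ ^ 2) = Real.exp (2 * a * ‖v‖ ^ 2) := by
    rw [← Real.exp_add]; ring_nf
  have hav : Real.exp (a * ‖v‖ ^ 2) ≤ Real.exp (2 * a * ‖v‖ ^ 2) :=
    Real.exp_le_exp.2 (by nlinarith [sq_nonneg ‖v‖])
  have hw1 : 1 ≤ Real.exp (2 * a * ‖w‖ ^ 2) := Real.one_le_exp (by positivity)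
  have hv1 : 1 ≤ Real.exp (2 * a * ‖v‖ ^ 2) := Real.one_le_exp (by positivity)
  set ev := Real.exp (a * ‖v‖ ^ 2) with hev
  set Ev := Real.exp (2 * a * ‖v‖ ^ 2) with hEv
  set Ew := Real.exp (2 * a * ‖w‖ ^ 2) with hEw
  set eL := Real.exp (-(a * L)) with heL
  have hev0 : 0 < ev := Real.exp_pos _
  have heL0 : 0 < eL := Real.exp_pos _
  -- `min(…) ‖v − w‖ ≤ eL · ev · (‖v‖ + ‖w‖)`
  have h1 : min 1 (Real.exp (a * (‖v‖ ^ 2 - L))) * ‖v - w‖ ≤ eL * ev * (‖v‖ + ‖w‖) :=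
    mul_le_mul hmin hvw (norm_nonneg _) (by positivity)
  -- `ev ‖v‖ ≤ (1 + a⁻¹) Ev ≤ (1 + a⁻¹) Ev Ew` and `ev ‖w‖ ≤ Ev (1 + (2a)⁻¹) Ew`
  have h2 : ev * ‖v‖ ≤ (1 + a⁻¹) * (Ev * Ew) := by
    calc ev * ‖v‖ ≤ ev * ((1 + a⁻¹) * ev) := mul_le_mul_of_nonneg_left hv hev0.le
      _ = (1 + a⁻¹) * Ev := by rw [← hea]; ring
      _ = (1 + a⁻¹) * (Ev * 1) := by rw [mul_one]
      _ ≤ (1 + a⁻¹) * (Ev * Ew) := by gcongr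
  have h3 : ev * ‖w‖ ≤ (1 + (2 * a)⁻¹) * (Ev * Ew) := by
    calc ev * ‖w‖ ≤ Ev * ((1 + (2 * a)⁻¹) * Ew) :=
          mul_le_mul hav hw (norm_nonneg _) (Real.exp_nonneg _)
      _ = (1 + (2 * a)⁻¹) * (Ev * Ew) := by ring
  calc min 1 (Real.exp (a * (‖v‖ ^ 2 - L))) * ‖v - w‖ ≤ eL * ev * (‖v‖ + ‖w‖) := h1
    _ = eL * (ev * ‖v‖ + ev * ‖w‖) := by ring
    _ ≤ eL * ((1 + a⁻¹) * (Ev * Ew) + (1 + (2 * a)⁻¹) * (Ev * Ew)) :=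
        mul_le_mul_of_nonneg_left (add_le_add h2 h3) heL0.le
    _ = eL * (2 + a⁻¹ + (2 * a)⁻¹) * (Ev * Ew) := by ring

/-! ## Stub 3 from the two route items -/

/-- **Energetic collisions are rare in the mean, given `GaussianVelocityTails` and
`ContactIntensityDominationOneRare`** — the registered statement of `stub_energeticCollisionsRare`
(crux line `registered` of `MaxSpeedBoundLog`, stmt-9629) derived from the route items stmt-9633 and
stmt-16939: see the module docstring for the proof. -/
theorem energeticCollisionsRare_of
    (hT : Summit.AtomisticToContinuum.HydrodynamicLimit.Theses.SpeedCapSurgery.GaussianVelocityTails)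
    (hO : Summit.AtomisticToContinuum.HydrodynamicLimit.Theses.SpeedCapSurgery.ContactIntensityDominationOneRare) :
    ∀ (a₀ θ₀ : Literature.MathematicalPhysics.KineticTheory.T3 → ℝ)
      (u₀ : Literature.MathematicalPhysics.KineticTheory.T3 → Literature.MathematicalPhysics.KineticTheory.V3),
      Continuous a₀ → Continuous θ₀ → Continuous u₀ → (∀ x, 0 < a₀ x) → (∀ x, 0 < θ₀ x) →
      ∃ σ₀ : ℝ, 0 < σ₀ ∧ ∀ σ : ℝ, 0 < σ → σ < σ₀ → ∀ t : ℝ, 0 ≤ t →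
      ∀ Φ : (N : ℕ) → Literature.Analysis.FluidPDE.HardSphereFlow
          (Literature.Analysis.FluidPDE.Torus.geometry (Fin 3))
          (Literature.MathematicalPhysics.KineticTheory.hsDiameter σ N) (N + 1),
      ∃ C : ℝ, 0 ≤ C ∧
      ∃ g : (N : ℕ) → Literature.Analysis.FluidPDE.Config (N + 1) (Fin 3) Literature.MathematicalPhysics.KineticTheory.T3 → ℝ≥0∞,
        (∀ N, Measurable (g N)) ∧
        (∀ N, ∀ z ∈ (Φ N).good,
          ((Set.ncard {r ∈ Set.Ioc 0 t | ∃ i j : Fin (N + 1), i ≠ j ∧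
              (Φ N).flow r z ∈ Literature.Analysis.FluidPDE.contactSet
                  (Literature.Analysis.FluidPDE.Torus.geometry (Fin 3)) (N + 1)
                  (Literature.MathematicalPhysics.KineticTheory.hsDiameter σ N) i j ∧
              (C * Real.sqrt (Real.log ((N : ℝ) + 2))) ^ 2 <
                ‖((Φ N).flow r z i).2‖ ^ 2 + ‖((Φ N).flow r z j).2‖ ^ 2} : ℕ) : ℝ≥0∞) ≤ g N z) ∧
        Filter.Tendsto (fun N : ℕ => ∫⁻ z, g N z ∂(Literature.MathematicalPhysics.KineticTheory.localGibbsLaw σ a₀ u₀ θ₀ N (Φ N)))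
          Filter.atTop (nhds 0) := by
  intro a₀ θ₀ u₀ ha hθ hu hap hθp
  obtain ⟨σ₁, hσ₁, H1⟩ := hT a₀ θ₀ u₀ ha hθ hu hap hθp
  obtain ⟨σ₂, hσ₂, H2⟩ := hO a₀ θ₀ u₀ ha hθ hu hap hθp
  refine ⟨min (min σ₁ σ₂) (1 / 2), by positivity, fun σ hσ hσlt t ht Φ => ?_⟩
  have hσ1 : σ < σ₁ := hσlt.trans_le ((min_le_left _ _).trans (min_le_left _ _))
  have hσ2 : σ < σ₂ := hσlt.trans_le ((min_le_left _ _).trans (min_le_right _ _))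
  have hσhalf : σ < 1 / 2 := hσlt.trans_le (min_le_right _ _)
  -- the window `(0, 0]` is empty: nothing to count
  rcases ht.eq_or_lt with rfl | htpos
  · refine ⟨0, le_rfl, fun _ _ => 0, fun _ => measurable_const, fun N z _ => ?_, ?_⟩
    swap
    · simpa only [lintegral_zero] using tendsto_const_nhds
    have hempty : {r ∈ Set.Ioc (0 : ℝ) 0 | ∃ i j : Fin (N + 1), i ≠ j ∧
        (Φ N).flow r z ∈ contactSet (Torus.geometry (Fin 3)) (N + 1) (hsDiameter σ N) i j ∧
        (0 * Real.sqrt (Real.log ((N : ℝ) + 2))) ^ 2 <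
          ‖((Φ N).flow r z i).2‖ ^ 2 + ‖((Φ N).flow r z j).2‖ ^ 2} = ∅ := by
      ext r
      simp only [Set.Ioc_self, mem_empty_iff_false, false_and, mem_setOf_eq]
    rw [hempty, Set.ncard_empty, Nat.cast_zero]
  -- the two route items at horizon `T = t`
  obtain ⟨c, hc, CT, hCT, N₁, hmom⟩ := H1 σ hσ hσ1 t htpos Φ
  obtain ⟨CO, hCO, N₂, hceil⟩ := H2 σ hσ hσ2 t htpos Φ
  -- constants: `a = c/2`, level constant `C₁ = √(12/c)` (so that `a C₁²/2 = 3`)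
  set a : ℝ := c / 2 with hadef
  have ha0 : 0 < a := by positivity
  have h2a : 2 * a = c := by rw [hadef]; ring
  set C₁ : ℝ := Real.sqrt (12 / c) with hC₁
  have hC₁0 : 0 ≤ C₁ := Real.sqrt_nonneg _
  have haC : a * C₁ ^ 2 / 2 = 3 := by
    rw [hC₁, Real.sq_sqrt (by positivity), hadef]
    field_simp
    ring
  -- levels, marks, majorants
  set lev : ℕ → ℝ := fun N => C₁ * Real.sqrt (Real.log ((N : ℝ) + 2)) with hlev
  set L : ℕ → ℝ := fun N => lev N ^ 2 / 2 with hL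
  set ψ : ℕ → V3 → ℝ≥0∞ := fun N v => ENNReal.ofReal (min 1 (Real.exp (a * (‖v‖ ^ 2 - L N)))) with hψ
  have hψc : ∀ N, Continuous (ψ N) := fun N => ENNReal.continuous_ofReal.comp (by fun_prop)
  have hψ1 : ∀ (N : ℕ) (v : V3), lev N ^ 2 < 2 * ‖v‖ ^ 2 → 1 ≤ ψ N v := by
    intro N v hv
    have hpos : 0 < a * (‖v‖ ^ 2 - L N) := mul_pos ha0 (by simp only [hL]; linarith)
    have h1 : (1 : ℝ) ≤ Real.exp (a * (‖v‖ ^ 2 - L N)) := Real.one_le_exp hpos.le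
    simp only [hψ, min_eq_left h1, ENNReal.ofReal_one, le_refl]
  set S : ℕ → Set VelEvent := fun N => {q | lev N ^ 2 < ‖q.2.1‖ ^ 2 + ‖q.2.2‖ ^ 2} with hS
  set g : (N : ℕ) → Config (N + 1) (Fin 3) T3 → ℝ≥0∞ := fun N =>
    (Φ N).good.indicator (eventSum (Φ N) 0 t (S N)) with hg
  refine ⟨C₁, hC₁0, g, fun N => ?_, fun N z hz => ?_, ?_⟩
  · exact censusLedger_eventMeasurable σ hσ hσhalf N (Φ N) 0 t (S N) (measurableSet_energeticEvent _)
  · simp only [hg, indicator_of_mem hz]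
    exact ncard_energetic_le_eventSum hσ hσhalf (Φ N) hz _ t
  -- the mean bound for `N ≥ max N₁ N₂`
  set P : (N : ℕ) → Measure (Config (N + 1) (Fin 3) T3) := fun N => localGibbsLaw σ a₀ u₀ θ₀ N (Φ N)
    with hP
  -- (i) `g N ≤` the one-rare ordered-pair sum with mark `ψ N` and `k = 0`, everywhere
  have hdom : ∀ (N : ℕ) (z : Config (N + 1) (Fin 3) T3), g N z ≤
      ∑ᶠ τ ∈ collisionTimes (Torus.geometry (Fin 3)) (hsDiameter σ N) (fun r => (Φ N).flow r z) ∩ Set.Ioc 0 t,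
        ∑ i : Fin (N + 1), ∑ j : Fin (N + 1), if i = j then (0 : ℝ≥0∞) else
          (contactSet (Torus.geometry (Fin 3)) (N + 1) (hsDiameter σ N) i j).indicator
            (fun y => (fun p : V3 × V3 => ψ N p.1 * ENNReal.ofReal ((1 + ‖p.2‖) ^ (0 : ℕ)))
              ((((collidePair (Torus.geometry (Fin 3)) i j y)) i).2,
                (((collidePair (Torus.geometry (Fin 3)) i j y)) j).2))
            ((Φ N).flow τ z) := by
    intro N z
    by_cases hz : z ∈ (Φ N).good
    · simp only [hg, indicator_of_mem hz]
      exact eventSum_le_oneRareSum hσ hσhalf (Φ N) hz (lev N) 0 t 0 (hψ1 N)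
    · simp only [hg, indicator_of_notMem hz]
      exact bot_le
  -- (ii) the velocity sums of exponential moments and their means
  have hexpm : ∀ (N : ℕ) (τ : ℝ), Measurable fun z : Config (N + 1) (Fin 3) T3 =>
      ∑ i : Fin (N + 1), ENNReal.ofReal (Real.exp (c * ‖((Φ N).flow τ z i).2‖ ^ 2)) := by
    intro N τ
    refine Finset.measurable_sum _ fun i _ => ?_
    have h := (((measurable_pi_apply i).comp ((Φ N).measurable_flow τ)).snd).norm
    exact (Real.measurable_exp.comp (measurable_const.mul (h.pow_const 2))).ennreal_ofReal
  have hsum_eq : ∀ (N : ℕ) (w : Config (N + 1) (Fin 3) T3),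
      ∑ i : Fin (N + 1), ENNReal.ofReal (Real.exp (c * ‖(w i).2‖ ^ 2)) =
        ((N + 1 : ℕ) : ℝ≥0∞) * Literature.Barriers.AtomisticToContinuum.expVelocityMoment c w := by
    intro N w
    rw [Literature.Barriers.AtomisticToContinuum.expVelocityMoment_eq,
      ← ENNReal.ofReal_natCast ((N + 1 : ℕ)), ← ENNReal.ofReal_mul (Nat.cast_nonneg _), ← mul_assoc,
      mul_inv_cancel₀ (by positivity), one_mul,
      ENNReal.ofReal_sum_of_nonneg fun i _ => Real.exp_nonneg _]
  have hmean : ∀ N : ℕ, N₁ ≤ N → ∀ τ ∈ Icc 0 t,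
      ∫⁻ z, ∑ i : Fin (N + 1), ENNReal.ofReal (Real.exp (c * ‖((Φ N).flow τ z i).2‖ ^ 2)) ∂(P N) ≤
        ((N + 1 : ℕ) : ℝ≥0∞) * CT := by
    intro N hN τ hτ
    simp_rw [hsum_eq N]
    rw [lintegral_const_mul' _ _ (ENNReal.natCast_ne_top (N + 1))]
    gcongr
    exact hmom N hN τ hτ
  -- (iii) the inner double integral of the ceiling's right-hand side
  set K₁ : ℝ := 2 + a⁻¹ + c⁻¹ with hK₁
  have hK₁0 : 0 ≤ K₁ := by positivity
  have hinner : ∀ N : ℕ, N₁ ≤ N → ∀ τ ∈ Icc 0 t,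
      (∫⁻ z, ∫⁻ z', (∑ i : Fin (N + 1), ∑ j : Fin (N + 1),
          ψ N ((((Φ N).flow τ z) i).2) * ENNReal.ofReal ((1 + ‖(((Φ N).flow τ z') j).2‖) ^ (0 : ℕ)) *
            ENNReal.ofReal ‖(((Φ N).flow τ z) i).2 - (((Φ N).flow τ z') j).2‖) ∂(P N) ∂(P N)) ≤
        ENNReal.ofReal (Real.exp (-(a * L N)) * K₁) * ((((N + 1 : ℕ) : ℝ≥0∞) * CT) ^ 2) := by
    intro N hN τ hτ
    -- pointwise Chernoff bound on the summand
    have hpt : ∀ (v w : V3), ψ N v * ENNReal.ofReal ((1 + ‖w‖) ^ (0 : ℕ)) * ENNReal.ofReal ‖v - w‖ ≤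
        ENNReal.ofReal (Real.exp (-(a * L N)) * K₁) *
          (ENNReal.ofReal (Real.exp (c * ‖v‖ ^ 2)) * ENNReal.ofReal (Real.exp (c * ‖w‖ ^ 2))) := by
      intro v w
      rw [pow_zero, ENNReal.ofReal_one, mul_one]
      have h := oneRareMark_mul_norm_sub_le ha0 (L N) v w
      rw [h2a] at h
      simp only [hψ]
      rw [← ENNReal.ofReal_mul (le_min zero_le_one (Real.exp_nonneg _)),
        ← ENNReal.ofReal_mul (Real.exp_nonneg _), ← ENNReal.ofReal_mul (by positivity)]
      exact ENNReal.ofReal_le_ofReal h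
    set A : Config (N + 1) (Fin 3) T3 → ℝ≥0∞ := fun z =>
      ∑ i : Fin (N + 1), ENNReal.ofReal (Real.exp (c * ‖((Φ N).flow τ z i).2‖ ^ 2)) with hA
    have hAm : Measurable A := hexpm N τ
    have hAint : ∫⁻ z, A z ∂(P N) ≤ ((N + 1 : ℕ) : ℝ≥0∞) * CT := hmean N hN τ hτ
    -- the double sum is at most `const · A z · A z'`
    have hsum : ∀ z z' : Config (N + 1) (Fin 3) T3,
        (∑ i : Fin (N + 1), ∑ j : Fin (N + 1),
          ψ N ((((Φ N).flow τ z) i).2) * ENNReal.ofReal ((1 + ‖(((Φ N).flow τ z') j).2‖) ^ (0 : ℕ)) *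
            ENNReal.ofReal ‖(((Φ N).flow τ z) i).2 - (((Φ N).flow τ z') j).2‖) ≤
        ENNReal.ofReal (Real.exp (-(a * L N)) * K₁) * (A z * A z') := by
      intro z z'
      calc (∑ i : Fin (N + 1), ∑ j : Fin (N + 1),
            ψ N ((((Φ N).flow τ z) i).2) * ENNReal.ofReal ((1 + ‖(((Φ N).flow τ z') j).2‖) ^ (0 : ℕ)) *
              ENNReal.ofReal ‖(((Φ N).flow τ z) i).2 - (((Φ N).flow τ z') j).2‖)
          ≤ ∑ i : Fin (N + 1), ∑ j : Fin (N + 1), ENNReal.ofReal (Real.exp (-(a * L N)) * K₁) *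
              (ENNReal.ofReal (Real.exp (c * ‖((Φ N).flow τ z i).2‖ ^ 2)) *
                ENNReal.ofReal (Real.exp (c * ‖((Φ N).flow τ z' j).2‖ ^ 2))) :=
            Finset.sum_le_sum fun i _ => Finset.sum_le_sum fun j _ => hpt _ _
        _ = ENNReal.ofReal (Real.exp (-(a * L N)) * K₁) * (A z * A z') := by
            simp only [hA]
            rw [Finset.sum_mul_sum, Finset.mul_sum]
            exact Finset.sum_congr rfl fun i _ => by rw [Finset.mul_sum]
    calc (∫⁻ z, ∫⁻ z', (∑ i : Fin (N + 1), ∑ j : Fin (N + 1),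
            ψ N ((((Φ N).flow τ z) i).2) * ENNReal.ofReal ((1 + ‖(((Φ N).flow τ z') j).2‖) ^ (0 : ℕ)) *
              ENNReal.ofReal ‖(((Φ N).flow τ z) i).2 - (((Φ N).flow τ z') j).2‖) ∂(P N) ∂(P N))
        ≤ ∫⁻ z, ∫⁻ z', ENNReal.ofReal (Real.exp (-(a * L N)) * K₁) * (A z * A z') ∂(P N) ∂(P N) :=
          lintegral_mono fun z => lintegral_mono fun z' => hsum z z'
      _ = ENNReal.ofReal (Real.exp (-(a * L N)) * K₁) * ((∫⁻ z, A z ∂(P N)) * (∫⁻ z', A z' ∂(P N))) := by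
          have h1 : ∀ z, ∫⁻ z', ENNReal.ofReal (Real.exp (-(a * L N)) * K₁) * (A z * A z') ∂(P N) =
              ENNReal.ofReal (Real.exp (-(a * L N)) * K₁) * (A z * ∫⁻ z', A z' ∂(P N)) := by
            intro z
            rw [lintegral_const_mul _ (hAm.const_mul _), lintegral_const_mul _ hAm]
          simp_rw [h1]
          rw [lintegral_const_mul _ (hAm.mul_const _), lintegral_mul_const _ hAm]
      _ ≤ ENNReal.ofReal (Real.exp (-(a * L N)) * K₁) * ((((N + 1 : ℕ) : ℝ≥0∞) * CT) ^ 2) := by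
          rw [sq]
          gcongr
  -- (iv) the mean of `g N`
  have hbound : ∀ N : ℕ, max N₁ N₂ ≤ N →
      ∫⁻ z, g N z ∂(P N) ≤ CO * ENNReal.ofReal ((σ ^ 2 * ((N + 1 : ℕ) : ℝ) ^ ((1 : ℝ) / 3)) / ((N + 1 : ℕ) : ℝ)) *
        (ENNReal.ofReal (Real.exp (-(a * L N)) * K₁) * ((((N + 1 : ℕ) : ℝ≥0∞) * CT) ^ 2) * ENNReal.ofReal t) := by
    intro N hN
    have hN1 : N₁ ≤ N := (le_max_left _ _).trans hN
    have hN2 : N₂ ≤ N := (le_max_right _ _).trans hN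
    have hc0 := hceil N hN2 0 t le_rfl htpos.le le_rfl 0 (by norm_num) (ψ N) (hψc N)
    calc ∫⁻ z, g N z ∂(P N)
        ≤ ∫⁻ z, (∑ᶠ τ ∈ collisionTimes (Torus.geometry (Fin 3)) (hsDiameter σ N) (fun r => (Φ N).flow r z) ∩
              Set.Ioc 0 t,
            ∑ i : Fin (N + 1), ∑ j : Fin (N + 1), if i = j then (0 : ℝ≥0∞) else
              (contactSet (Torus.geometry (Fin 3)) (N + 1) (hsDiameter σ N) i j).indicator
                (fun y => (fun p : V3 × V3 => ψ N p.1 * ENNReal.ofReal ((1 + ‖p.2‖) ^ (0 : ℕ)))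
                  ((((collidePair (Torus.geometry (Fin 3)) i j y)) i).2,
                    (((collidePair (Torus.geometry (Fin 3)) i j y)) j).2))
                ((Φ N).flow τ z)) ∂(P N) := lintegral_mono (hdom N)
      _ ≤ CO * ENNReal.ofReal ((σ ^ 2 * ((N + 1 : ℕ) : ℝ) ^ ((1 : ℝ) / 3)) / ((N + 1 : ℕ) : ℝ)) *
            ∫⁻ τ in Set.Ioc 0 t, (∫⁻ z, ∫⁻ z', (∑ i : Fin (N + 1), ∑ j : Fin (N + 1),
              ψ N ((((Φ N).flow τ z) i).2) * ENNReal.ofReal ((1 + ‖(((Φ N).flow τ z') j).2‖) ^ (0 : ℕ)) *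
                ENNReal.ofReal ‖(((Φ N).flow τ z) i).2 - (((Φ N).flow τ z') j).2‖) ∂(P N) ∂(P N)) := hc0
      _ ≤ CO * ENNReal.ofReal ((σ ^ 2 * ((N + 1 : ℕ) : ℝ) ^ ((1 : ℝ) / 3)) / ((N + 1 : ℕ) : ℝ)) *
            ∫⁻ _τ in Set.Ioc 0 t, ENNReal.ofReal (Real.exp (-(a * L N)) * K₁) *
              ((((N + 1 : ℕ) : ℝ≥0∞) * CT) ^ 2) := by
          exact mul_le_mul' le_rfl
            (setLIntegral_mono' measurableSet_Ioc fun τ hτ => hinner N hN1 τ (Ioc_subset_Icc_self hτ))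
      _ = _ := by
          rw [setLIntegral_const, Real.volume_Ioc, sub_zero]
  -- (v) the bound tends to `0`: `e^{-a L_N} = (N+2)^{-3}`, everything else polynomial
  have hexp : ∀ N : ℕ, Real.exp (-(a * L N)) = ((N : ℝ) + 2)⁻¹ ^ 3 := by
    intro N
    have hlog : 0 ≤ Real.log ((N : ℝ) + 2) := Real.log_nonneg (by linarith [(Nat.cast_nonneg N : (0 : ℝ) ≤ N)])
    have h1 : a * L N = 3 * Real.log ((N : ℝ) + 2) := by
      simp only [hL, hlev]
      rw [mul_pow, Real.sq_sqrt hlog]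
      have : a * (C₁ ^ 2 * Real.log ((N : ℝ) + 2) / 2) = (a * C₁ ^ 2 / 2) * Real.log ((N : ℝ) + 2) := by ring
      rw [this, haC]
    rw [h1, show (3 : ℝ) * Real.log ((N : ℝ) + 2) = ((3 : ℕ) : ℝ) * Real.log ((N : ℝ) + 2) by norm_num,
      ← Real.log_pow, Real.exp_neg, Real.exp_log (by positivity), inv_pow]
  -- the real majorant `B / (N + 2)`
  have hCOr : CO ≤ ENNReal.ofReal (CO.toReal + 1) :=
    calc CO = ENNReal.ofReal CO.toReal := (ENNReal.ofReal_toReal hCO.ne).symm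
      _ ≤ ENNReal.ofReal (CO.toReal + 1) := ENNReal.ofReal_le_ofReal (lt_add_one _).le
  have hCTr : CT ≤ ENNReal.ofReal (CT.toReal + 1) :=
    calc CT = ENNReal.ofReal CT.toReal := (ENNReal.ofReal_toReal hCT.ne).symm
      _ ≤ ENNReal.ofReal (CT.toReal + 1) := ENNReal.ofReal_le_ofReal (lt_add_one _).le
  set B : ℝ := (CO.toReal + 1) * K₁ * (CT.toReal + 1) ^ 2 * t with hB
  have hmaj : ∀ N : ℕ, max N₁ N₂ ≤ N → ∫⁻ z, g N z ∂(P N) ≤ ENNReal.ofReal (B / ((N : ℝ) + 2)) := by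
    intro N hN
    refine (hbound N hN).trans ?_
    have hN0 : (0 : ℝ) < (N : ℝ) + 2 := by positivity
    -- `σ² (N+1)^{1/3} / (N+1) ≤ 1`
    have hgeom : σ ^ 2 * ((N + 1 : ℕ) : ℝ) ^ ((1 : ℝ) / 3) / ((N + 1 : ℕ) : ℝ) ≤ 1 := by
      have hN1 : (1 : ℝ) ≤ ((N + 1 : ℕ) : ℝ) := by exact_mod_cast Nat.succ_le_succ (Nat.zero_le N)
      have hrt : ((N + 1 : ℕ) : ℝ) ^ ((1 : ℝ) / 3) ≤ ((N + 1 : ℕ) : ℝ) := by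
        conv_rhs => rw [← Real.rpow_one (((N + 1 : ℕ) : ℝ))]
        exact Real.rpow_le_rpow_of_exponent_le hN1 (by norm_num)
      have hσ1 : σ ^ 2 ≤ 1 := by nlinarith
      rw [div_le_one (by positivity)]
      calc σ ^ 2 * ((N + 1 : ℕ) : ℝ) ^ ((1 : ℝ) / 3) ≤ 1 * ((N + 1 : ℕ) : ℝ) :=
            mul_le_mul hσ1 hrt (by positivity) zero_le_one
        _ = ((N + 1 : ℕ) : ℝ) := one_mul _
    -- `(N+1)² (N+2)^{-3} ≤ (N+2)^{-1}`
    have hpoly : ((N + 1 : ℕ) : ℝ) ^ 2 * (((N : ℝ) + 2)⁻¹ ^ 3) ≤ ((N : ℝ) + 2)⁻¹ := by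
      have hratio : ((N + 1 : ℕ) : ℝ) / ((N : ℝ) + 2) ≤ 1 := by
        rw [div_le_one hN0]; push_cast; linarith
      have hratio0 : 0 ≤ ((N + 1 : ℕ) : ℝ) / ((N : ℝ) + 2) := by positivity
      have hsq : (((N + 1 : ℕ) : ℝ) / ((N : ℝ) + 2)) ^ 2 ≤ 1 := pow_le_one₀ hratio0 hratio
      rw [show ((N : ℝ) + 2)⁻¹ ^ 3 = (((N : ℝ) + 2)⁻¹ ^ 2) * ((N : ℝ) + 2)⁻¹ by ring, ← mul_assoc,
        ← mul_pow, ← div_eq_mul_inv]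
      calc (((N + 1 : ℕ) : ℝ) / ((N : ℝ) + 2)) ^ 2 * ((N : ℝ) + 2)⁻¹ ≤ 1 * ((N : ℝ) + 2)⁻¹ :=
            mul_le_mul_of_nonneg_right hsq (by positivity)
        _ = ((N : ℝ) + 2)⁻¹ := one_mul _
    calc CO * ENNReal.ofReal ((σ ^ 2 * ((N + 1 : ℕ) : ℝ) ^ ((1 : ℝ) / 3)) / ((N + 1 : ℕ) : ℝ)) *
          (ENNReal.ofReal (Real.exp (-(a * L N)) * K₁) * ((((N + 1 : ℕ) : ℝ≥0∞) * CT) ^ 2) * ENNReal.ofReal t)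
        ≤ ENNReal.ofReal (CO.toReal + 1) * ENNReal.ofReal 1 *
          (ENNReal.ofReal (((N : ℝ) + 2)⁻¹ ^ 3 * K₁) *
            ((ENNReal.ofReal ((N + 1 : ℕ) : ℝ) * ENNReal.ofReal (CT.toReal + 1)) ^ 2) * ENNReal.ofReal t) := by
          rw [hexp N, ENNReal.ofReal_natCast]
          gcongr
      _ = ENNReal.ofReal ((CO.toReal + 1) * ((((N : ℝ) + 2)⁻¹ ^ 3 * K₁) *
            ((((N + 1 : ℕ) : ℝ) * (CT.toReal + 1)) ^ 2) * t)) := by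
          rw [ENNReal.ofReal_one, mul_one, ← ENNReal.ofReal_mul (by positivity), ← ENNReal.ofReal_pow (by positivity),
            ← ENNReal.ofReal_mul (by positivity), ← ENNReal.ofReal_mul (by positivity),
            ← ENNReal.ofReal_mul (by positivity)]
      _ ≤ ENNReal.ofReal (B / ((N : ℝ) + 2)) := by
          refine ENNReal.ofReal_le_ofReal ?_
          have hrew : (CO.toReal + 1) * ((((N : ℝ) + 2)⁻¹ ^ 3 * K₁) *
              ((((N + 1 : ℕ) : ℝ) * (CT.toReal + 1)) ^ 2) * t) =
              B * (((N + 1 : ℕ) : ℝ) ^ 2 * (((N : ℝ) + 2)⁻¹ ^ 3)) := by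
            rw [hB]; ring
          rw [hrew, div_eq_mul_inv]
          exact mul_le_mul_of_nonneg_left hpoly (by positivity)
  have hlim : Tendsto (fun N : ℕ => ENNReal.ofReal (B / ((N : ℝ) + 2))) atTop (𝓝 0) := by
    rw [← ENNReal.ofReal_zero]
    refine ENNReal.tendsto_ofReal ?_
    have h : Tendsto (fun N : ℕ => (N : ℝ) + 2) atTop atTop :=
      tendsto_atTop_add_const_right _ _ tendsto_natCast_atTop_atTop
    exact h.const_div_atTop B
  refine tendsto_of_tendsto_of_tendsto_of_le_of_le' tendsto_const_nhds hlim
    (Eventually.of_forall fun N => bot_le) ?_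
  filter_upwards [eventually_ge_atTop (max N₁ N₂)] with N hN using hmaj N hN

end Summit.AtomisticToContinuum.HydrodynamicLimit.Theorems.MaxSpeedBoundLogLine

end
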